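-- PORTED from the prior programme stockroom (kernel-checked there, proofs untouched):
--   reserve/prior-2001/Prior/HodgeConjecture/HodgeConjecture/Hodge_WRankFourWeilFacesY1_A1Faces.lean
-- Changes: `import HarnessLib` dropped; outer namespace -> HodgeCM.Prior.Faces. Attribution: 2001 programme seats (docstrings).

import Mathlib

/-!
# Prior-program stockroom file `Hodge_WRankFourWeilFacesY1_A1Faces`

Imported from the 2001 program: `summits/hodge-w-rank-four-weil-faces/free/y1/lean/perl34/S1/A1_Faces.lean` (commit a463a4c8cc18),
free `y1` of summit `hodge-w-rank-four-weil-faces`; prior STATUS `-`; imported 2026-08-13.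
Relevant to: Summit.HodgeConjecture.HodgeConjecture (the statement via the prior narrowed target `hodge-w-rank-four-weil-faces`); container free `y1`
Inspiration note: none (not a primary-summit route).
Existing Theses decls it bears on: not assessed at import (planners/provers decide; see reserve/prior-2001/README.md).
Mechanical changes only: provenance header, whole body wrapped in the namespace below (original namespaces nested
inside), stub docstrings on undocumented declarations, `#print`/`#check`/`#eval` lines dropped. Proofs untouched.
NOT part of the `lean/` tree: it enters `Summits/…/Theorems` only when a prover adapts it to a Theses decl (route item).
-/

namespace HodgeCM.Prior.Faces

/-
A1_Faces.lean — PERL34 tranche seat S1, item A1 (PERL34-FORMALIZE-PLAN.md v2 @e3be098b §(A) A1):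
face / tetrahedron combinatorics.
  * rank-four faces and their corners (rfwf paper.tex d:face ll.54-58),
  * l:hodge: Σᵢ 1_{Φᵢ} = 2 as functions, with the per-block two-of-four structure
    (rfwf ll.60-68),
  * corners pairwise distinct; Θ-normalisation and the tetrahedron identity
    1_{Θ₁}+1_{Θ₂} = 1_{Θ₃}+1_{Θ₄} (rfwf eq:theta ll.79-84, l:tetra ll.85-96),
  * four Θᵢ pairwise distinct iff a third place exists ("g ≥ 3"; rfwf l.86 and the
    converse: with no third place Φ₄ = Φ̄₁),
  * PerL rem:tetra (d912a121 ll.208-214): transport of the identity under pullback /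
    inversion / translation lives in the Common transport lemmas inlined below,
  * sign-vector model ("types as Fin g → Bool", plan A1) with the g = 3 tetrahedron
    t¹ t² t³ t⁴ of PerL l.60 as a decidable smoke test, and the g = 2 collapse.
Toolchain: checked standalone by kit/lean_check.py (imports resolve against Mathlib
only), so the shared vocabulary of ../Common/Types.lean is INLINED VERBATIM between the
BEGIN/END markers below; ../Common/Types.lean is the canonical text of that region.
-/
namespace Perl34

-- ===== BEGIN [Common/Types.lean verbatim] =====

variable {X : Type*} [DecidableEq X]

/-- CM-type property on a set with involution `ι`: `Φ` contains exactly one of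
`x, ι x` for every `x` (`X = Φ ⊔ ιΦ`). rfwf l.46; PerL l.53. -/
def IsCMS (ι : X → X) (Φ : Finset X) : Prop := ∀ x : X, x ∈ Φ ↔ ι x ∉ Φ

/-- Integer indicator `1_Φ` (as in RfwfAllgGroup.indG). -/
def indX (Φ : Finset X) : X → ℤ := fun x => if x ∈ Φ then 1 else 0

/-- Sign of a type at a representative `ρ` of a place: `m_b(Ψ) = -1` if `ρ_b ∈ Ψ`,
`+1` if `ρ̄_b ∈ Ψ` (PerL l.54). -/
def sgn (Φ : Finset X) (ρ : X) : ℤ := if ρ ∈ Φ then -1 else 1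

/-- The place (ι-orbit) `{t, ι t}` of `t` (rfwf l.46; RfwfAllgGroup.orb). -/
def orbS (ι : X → X) (t : X) : Finset X := {t, ι t}

/-- Pair-sum (tetrahedron) identity `1_{Ψ₁}+1_{Ψ₂} = 1_{Ψ₃}+1_{Ψ₄}` as functions on `X`
(PerL rem:tetra l.210-212; rfwf l:tetra l.86). Hypothesis (H1) of the plan's C6. -/
def PairSum (Ψ₁ Ψ₂ Ψ₃ Ψ₄ : Finset X) : Prop :=
  ∀ x : X, indX Ψ₁ x + indX Ψ₂ x = indX Ψ₃ x + indX Ψ₄ x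

/-- Conjugate type `Φ̄ = ιΦ` (rfwf l.48: `Φ̄ := cΦ`). -/
def conjS (ι : X → X) (Φ : Finset X) : Finset X := Φ.image ι

/-- `Φ^{(π)}`: `Φ` with its element at the place of `t` replaced by the other one
(rfwf l.47), i.e. symmetric difference with the orbit `{t, ι t}` (RfwfAllgGroup's flip). -/
def flipP (ι : X → X) (t : X) (Φ : Finset X) : Finset X := symmDiff Φ (orbS ι t)

section basic

variable {ι : X → X} {Φ Φ' : Finset X}

/-- (no docstring in the 2001 source) -/
lemma indX_of_mem {x : X} (h : x ∈ Φ) : indX Φ x = 1 := by simp [indX, h]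

/-- (no docstring in the 2001 source) -/
lemma indX_of_not_mem {x : X} (h : x ∉ Φ) : indX Φ x = 0 := by simp [indX, h]

/-- (no docstring in the 2001 source) -/
lemma sgn_of_mem {x : X} (h : x ∈ Φ) : sgn Φ x = -1 := by simp [sgn, h]

/-- (no docstring in the 2001 source) -/
lemma sgn_of_not_mem {x : X} (h : x ∉ Φ) : sgn Φ x = 1 := by simp [sgn, h]

/-- `m_b ∈ {±1}` (PerL l.54; plan A2 "m_b∈{±1}"). -/
lemma sgn_eq_neg_one_or_one (Φ : Finset X) (x : X) : sgn Φ x = -1 ∨ sgn Φ x = 1 := by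
  by_cases h : x ∈ Φ
  · exact Or.inl (sgn_of_mem h)
  · exact Or.inr (sgn_of_not_mem h)

/-- `sgn = 1 - 2·ind`. -/
lemma sgn_eq_one_sub_two_ind (Φ : Finset X) (x : X) : sgn Φ x = 1 - 2 * indX Φ x := by
  by_cases h : x ∈ Φ <;> simp [sgn, indX, h]

/-- A CM type exists only where `ι` moves every point. -/
lemma IsCMS.iota_ne (hΦ : IsCMS ι Φ) (x : X) : ι x ≠ x := by
  intro he
  by_cases h : x ∈ Φ
  · exact (he ▸ (hΦ x).mp h) h
  · have h2 : ι x ∉ Φ := fun hm => h (he ▸ hm)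
    exact h ((hΦ x).mpr h2)

/-- Membership at the conjugate point (CM property, negated form). -/
lemma IsCMS.iota_mem_iff (hΦ : IsCMS ι Φ) {x : X} : ι x ∈ Φ ↔ x ∉ Φ := by
  constructor
  · intro h hx
    exact (hΦ x).mp hx h
  · intro hx
    by_contra h
    exact hx ((hΦ x).mpr h)

/-- The sign at the conjugate representative is the opposite (place-independence up to
the choice of representative; PerL l.51-54). -/
lemma IsCMS.sgn_iota (_hι : ∀ x, ι (ι x) = x) (hΦ : IsCMS ι Φ) (x : X) :
    sgn Φ (ι x) = -sgn Φ x := by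
  by_cases h : x ∈ Φ
  · simp [sgn_of_not_mem ((hΦ x).mp h), sgn_of_mem h]
  · simp [sgn_of_mem (hΦ.iota_mem_iff.mpr h), sgn_of_not_mem h]

/-- Two CM types agreeing at every chosen representative are equal: membership at `ι x`
is determined by membership at `x`. -/
lemma IsCMS.eq_of_sgn_eq (_hΦ : IsCMS ι Φ) (_hΦ' : IsCMS ι Φ')
    (h : ∀ x, sgn Φ x = sgn Φ' x) : Φ = Φ' := by
  ext x
  have hx := h x
  by_cases hm : x ∈ Φ
  · rw [sgn_of_mem hm] at hx
    constructor
    · intro _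
      by_contra hn
      rw [sgn_of_not_mem hn] at hx
      omega
    · intro _; exact hm
  · rw [sgn_of_not_mem hm] at hx
    constructor
    · intro hc; exact absurd hc hm
    · intro hm'
      rw [sgn_of_mem hm'] at hx
      omega

/-- Distinct CM types sharing the base point `φh` differ at some point outside the place
of `φh` (used for `Σ₁₂ ≠ ∅`, PerL lem:allowed(b) l.297, and rfwf l:tetra l.86-87). -/
lemma IsCMS.exists_differ_off_basepoint
    (hΦ : IsCMS ι Φ) (hΦ' : IsCMS ι Φ') {φh : X} (h1 : φh ∈ Φ) (h2 : φh ∈ Φ')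
    (hne : Φ ≠ Φ') : ∃ x, x ≠ φh ∧ x ≠ ι φh ∧ (x ∈ Φ ∧ x ∉ Φ' ∨ x ∉ Φ ∧ x ∈ Φ') := by
  have hdiff : ∃ x, x ∈ Φ ∧ x ∉ Φ' ∨ x ∉ Φ ∧ x ∈ Φ' := by
    by_contra hall
    push Not at hall
    exact hne (by
      ext x
      have := hall x
      tauto)
  obtain ⟨x, hx⟩ := hdiff
  refine ⟨x, ?_, ?_, hx⟩
  · rintro rfl; rcases hx with ⟨h, h'⟩ | ⟨h, h'⟩
    · exact h' h2
    · exact h h1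
  · rintro rfl
    rcases hx with ⟨h, h'⟩ | ⟨h, h'⟩
    · exact ((hΦ φh).mp h1) h
    · exact ((hΦ' φh).mp h2) h'

end basic

section transport

variable {ι : X → X} {Φ Φ' : Finset X}

/-- (no docstring in the 2001 source) -/
lemma mem_conjS (hι : ∀ x, ι (ι x) = x) {x : X} : x ∈ conjS ι Φ ↔ ι x ∈ Φ := by
  unfold conjS
  constructor
  · rintro h
    rcases Finset.mem_image.mp h with ⟨y, hy, rfl⟩
    rwa [hι y]
  · intro h
    exact Finset.mem_image.mpr ⟨ι x, h, hι x⟩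

/-- `1_{ιΦ} = 1 - 1_Φ` for a CM type (rfwf l:tetra proof l.90: `1_{cΦ} = 1 - 1_Φ`). -/
lemma indX_conjS (hι : ∀ x, ι (ι x) = x) (hΦ : IsCMS ι Φ) (x : X) :
    indX (conjS ι Φ) x = 1 - indX Φ x := by
  by_cases h : x ∈ Φ
  · simp [indX_of_mem h, indX_of_not_mem (fun hc => (hΦ x).mp h ((mem_conjS hι).mp hc))]
  · simp [indX_of_not_mem h,
      indX_of_mem ((mem_conjS hι).mpr (hΦ.iota_mem_iff.mpr h))]

/-- The conjugate of a CM type is a CM type. -/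
lemma IsCMS.conjS (hι : ∀ x, ι (ι x) = x) (hΦ : IsCMS ι Φ) :
    IsCMS ι (Perl34.conjS ι Φ) := by
  intro x
  rw [mem_conjS hι, mem_conjS hι, hι x]
  exact hΦ.iota_mem_iff

/-- (no docstring in the 2001 source) -/
lemma conjS_conjS (hι : ∀ x, ι (ι x) = x) : conjS ι (conjS ι Φ) = Φ := by
  ext x
  rw [mem_conjS hι, mem_conjS hι, hι x]

/-- (no docstring in the 2001 source) -/
lemma conjS_injective (hι : ∀ x, ι (ι x) = x) (h : conjS ι Φ = conjS ι Φ') : Φ = Φ' := by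
  have := congrArg (conjS ι) h
  rwa [conjS_conjS hι, conjS_conjS hι] at this

/-- (no docstring in the 2001 source) -/
lemma mem_orbS {t x : X} : x ∈ orbS ι t ↔ x = t ∨ x = ι t := by simp [orbS]

/-- (no docstring in the 2001 source) -/
lemma mem_flipP {t x : X} :
    x ∈ flipP ι t Φ ↔ (x ∈ Φ ∧ x ∉ orbS ι t) ∨ (x ∉ Φ ∧ x ∈ orbS ι t) := by
  unfold flipP
  rw [Finset.mem_symmDiff]
  tauto

/-- Flip at a place preserves the CM property (`ι` involutive). -/
lemma IsCMS.flipP (hι : ∀ x, ι (ι x) = x) (hΦ : IsCMS ι Φ) (t : X) :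
    IsCMS ι (Perl34.flipP ι t Φ) := by
  intro x
  have horb : ι x ∈ orbS ι t ↔ x ∈ orbS ι t := by
    rw [mem_orbS, mem_orbS]
    constructor
    · rintro (h | h)
      · right; rw [← h, hι]
      · left
        have := congrArg ι h
        rwa [hι, hι] at this
    · rintro (rfl | rfl)
      · right; rfl
      · left; exact hι t
  rw [mem_flipP, mem_flipP, horb, hΦ.iota_mem_iff]
  by_cases hm : x ∈ Φ <;> by_cases ho : x ∈ orbS ι t <;> simp [hm, ho]

/-- Membership after a flip, split by the place. -/
lemma mem_flipP_of_orb {t x : X} (h : x ∈ orbS ι t) : x ∈ flipP ι t Φ ↔ x ∉ Φ := by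
  rw [mem_flipP]
  by_cases hm : x ∈ Φ <;> simp [hm, h]

/-- (no docstring in the 2001 source) -/
lemma mem_flipP_of_not_orb {t x : X} (h : x ∉ orbS ι t) : x ∈ flipP ι t Φ ↔ x ∈ Φ := by
  rw [mem_flipP]
  by_cases hm : x ∈ Φ <;> simp [hm, h]

end transport

section groupLayer

variable {G : Type*} [Group G] [DecidableEq G]

/-- CM-type property on a group with involution `c` — definitionally
`RfwfAllgGroup.IsCMF` and `IsCMS (c * ·)`. -/
def IsCMF (c : G) (Φ : Finset G) : Prop := ∀ x : G, x ∈ Φ ↔ c * x ∉ Φ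

omit [DecidableEq G] in
/-- (no docstring in the 2001 source) -/
lemma isCMF_iff_isCMS {c : G} {Φ : Finset G} : IsCMF c Φ ↔ IsCMS (c * ·) Φ := Iff.rfl

/-- Left translate `aΦ` (PerL rem:tetra "translate by φ^h"). -/
def translT (a : G) (Φ : Finset G) : Finset G := Φ.image (a * ·)

/-- Inverse type `Φ⁻¹` (PerL eq:Psit, rem:tetra "invert"). -/
def invT (Φ : Finset G) : Finset G := Φ.image (·⁻¹)

/-- Pullback of a type along a map of ι-sets (PerL eq:Psit: `Φ̃_t = {g : g|_K ∈ Φ_t}`;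
rem:tetra "pull back to 𝒢"). -/
def pullT [Fintype G] {Y : Type*} [DecidableEq Y] (f : G → Y) (Φ : Finset Y) : Finset G :=
  Finset.univ.filter (fun g => f g ∈ Φ)

/-- (no docstring in the 2001 source) -/
lemma mem_translT {a x : G} {Φ : Finset G} : x ∈ translT a Φ ↔ a⁻¹ * x ∈ Φ := by
  unfold translT
  constructor
  · rintro h
    rcases Finset.mem_image.mp h with ⟨y, hy, rfl⟩
    rwa [inv_mul_cancel_left]
  · intro h
    exact Finset.mem_image.mpr ⟨a⁻¹ * x, h, by rw [mul_inv_cancel_left]⟩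

/-- (no docstring in the 2001 source) -/
lemma mem_invT {x : G} {Φ : Finset G} : x ∈ invT Φ ↔ x⁻¹ ∈ Φ := by
  unfold invT
  constructor
  · rintro h
    rcases Finset.mem_image.mp h with ⟨y, hy, rfl⟩
    rwa [inv_inv]
  · intro h
    exact Finset.mem_image.mpr ⟨x⁻¹, h, by rw [inv_inv]⟩

omit [Group G] [DecidableEq G] in
/-- (no docstring in the 2001 source) -/
lemma mem_pullT [Fintype G] {Y : Type*} [DecidableEq Y] {f : G → Y} {Φ : Finset Y}
    {g : G} : g ∈ pullT f Φ ↔ f g ∈ Φ := by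
  simp [pullT]

/-- Translation preserves the CM property (`c` central). -/
lemma IsCMF.translT {c a : G} {Φ : Finset G} (hcen : ∀ g, c * g = g * c)
    (hΦ : IsCMF c Φ) : IsCMF c (Perl34.translT a Φ) := by
  intro x
  rw [mem_translT, mem_translT]
  have h : a⁻¹ * (c * x) = c * (a⁻¹ * x) := by
    rw [← mul_assoc, ← hcen a⁻¹, mul_assoc]
  rw [h]
  exact hΦ (a⁻¹ * x)

/-- Inversion preserves the CM property (`c` central, `c² = 1`). -/
lemma IsCMF.invT {c : G} {Φ : Finset G} (hc2 : c * c = 1) (hcen : ∀ g, c * g = g * c)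
    (hΦ : IsCMF c Φ) : IsCMF c (Perl34.invT Φ) := by
  intro x
  rw [mem_invT, mem_invT]
  have h : (c * x)⁻¹ = c * x⁻¹ := by
    rw [mul_inv_rev, inv_eq_of_mul_eq_one_right hc2, hcen x⁻¹]
  rw [h]
  exact hΦ x⁻¹

omit [DecidableEq G] in
/-- Pullback along an equivariant map preserves the CM property. -/
lemma IsCMF.pullT [Fintype G] {c : G} {Y : Type*} [DecidableEq Y] {ιY : Y → Y}
    {f : G → Y} (hf : ∀ g, f (c * g) = ιY (f g)) {Φ : Finset Y} (hΦ : IsCMS ιY Φ) :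
    IsCMF c (Perl34.pullT f Φ) := by
  intro x
  rw [mem_pullT, mem_pullT, hf x]
  exact hΦ (f x)

/-- Indicator identities transport: translation. -/
lemma indX_translT {a : G} {Φ : Finset G} (x : G) :
    indX (translT a Φ) x = indX Φ (a⁻¹ * x) := by
  by_cases h : a⁻¹ * x ∈ Φ
  · rw [indX_of_mem (mem_translT.mpr h), indX_of_mem h]
  · rw [indX_of_not_mem (fun hc => h (mem_translT.mp hc)), indX_of_not_mem h]

/-- (no docstring in the 2001 source) -/
lemma indX_invT {Φ : Finset G} (x : G) : indX (invT Φ) x = indX Φ x⁻¹ := by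
  by_cases h : x⁻¹ ∈ Φ
  · rw [indX_of_mem (mem_invT.mpr h), indX_of_mem h]
  · rw [indX_of_not_mem (fun hc => h (mem_invT.mp hc)), indX_of_not_mem h]

omit [Group G] in
/-- (no docstring in the 2001 source) -/
lemma indX_pullT [Fintype G] {Y : Type*} [DecidableEq Y] {f : G → Y} {Φ : Finset Y}
    (g : G) : indX (pullT f Φ) g = indX Φ (f g) := by
  by_cases h : f g ∈ Φ
  · rw [indX_of_mem (mem_pullT.mpr h), indX_of_mem h]
  · rw [indX_of_not_mem (fun hc => h (mem_pullT.mp hc)), indX_of_not_mem h]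

/-- PairSum transports along translation, inversion and pullback (PerL rem:tetra proof
l.210-212: "pull back to 𝒢, invert, translate by φ^h"). -/
lemma PairSum.translT {a : G} {Ψ₁ Ψ₂ Ψ₃ Ψ₄ : Finset G} (h : PairSum Ψ₁ Ψ₂ Ψ₃ Ψ₄) :
    PairSum (translT a Ψ₁) (translT a Ψ₂) (translT a Ψ₃) (translT a Ψ₄) := by
  intro x
  simp only [indX_translT]
  exact h (a⁻¹ * x)

/-- (no docstring in the 2001 source) -/
lemma PairSum.invT {Ψ₁ Ψ₂ Ψ₃ Ψ₄ : Finset G} (h : PairSum Ψ₁ Ψ₂ Ψ₃ Ψ₄) :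
    PairSum (invT Ψ₁) (invT Ψ₂) (invT Ψ₃) (invT Ψ₄) := by
  intro x
  simp only [indX_invT]
  exact h x⁻¹

omit [Group G] in
/-- (no docstring in the 2001 source) -/
lemma PairSum.pullT [Fintype G] {Y : Type*} [DecidableEq Y] {f : G → Y}
    {Ψ₁ Ψ₂ Ψ₃ Ψ₄ : Finset Y} (h : PairSum Ψ₁ Ψ₂ Ψ₃ Ψ₄) :
    PairSum (pullT f Ψ₁) (pullT f Ψ₂) (pullT f Ψ₃) (pullT f Ψ₄) := by
  intro g
  simp only [indX_pullT]
  exact h (f g)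

/-- Distinctness transports: translation and inversion are injective on types;
pullback along a surjection is injective (PerL rem:tetra l.213: "the four Ψ_i are
pairwise distinct, since the t^i are"). -/
lemma translT_injective {a : G} {Φ Φ' : Finset G} (h : translT a Φ = translT a Φ') :
    Φ = Φ' := by
  ext x
  have := Finset.ext_iff.mp h (a * x)
  rwa [mem_translT, mem_translT, inv_mul_cancel_left] at this

/-- (no docstring in the 2001 source) -/
lemma invT_injective {Φ Φ' : Finset G} (h : invT Φ = invT Φ') : Φ = Φ' := by
  ext x
  have := Finset.ext_iff.mp h x⁻¹
  rwa [mem_invT, mem_invT, inv_inv] at this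

omit [Group G] [DecidableEq G] in
/-- (no docstring in the 2001 source) -/
lemma pullT_injective_of_surjective [Fintype G] {Y : Type*} [DecidableEq Y]
    {f : G → Y} (hf : Function.Surjective f) {Φ Φ' : Finset Y}
    (h : pullT f Φ = pullT f Φ') : Φ = Φ' := by
  ext y
  obtain ⟨g, rfl⟩ := hf y
  have := Finset.ext_iff.mp h g
  rwa [mem_pullT, mem_pullT] at this

end groupLayer

-- ===== END [Common/Types.lean verbatim] =====

/-! ## A1 proper: rank-four faces and their corners (rfwf d:face ll.54-58) -/


-- port_pkg: scope closed for this part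
end Perl34
end HodgeCM.Prior.Faces
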